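import Mathlib
import HarnessLib
import Summits.CriticalPhenomena.SAWScalingLimit.Theses.SAWDevelopingMap
import Literature.Probability.RandomPlanarGeometry.HexParafermion
import Literature.Probability.RandomPlanarGeometry.HexSAW
import Literature.Probability.RandomPlanarGeometry.ConformalMap

/-!
# Sketch — first lemmas of the crux ideas for `ObservableToSLE` (stmt-CriticalPhenomena-10472)

Ideator 2, round 1. Nothing here is proved; every `def … : Prop` must elaborate.

* `FloorRatioLimit`  — card `floor-ratio-restriction-bootstrap`, step S1: sliding the normalisation
  point along the flat floor turns two instances of `HexObservableLimit` into the limit of the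
  boundary partition-function ratio `F_δ(b′_δ)/F_δ(b_δ) → exp((5/8)(L_{b′} − L_b))`.
* `ShortChordLocality` — the one SAW a-priori estimate (anchor) that card needs.
* `TipReversal` — card `reversed-tip-terminal-harnack`, the exact reversal identity.
* `TerminalHarnack` — that card's open input (target-side ratio mixing of critical SAW masses).
-/

namespace Summit.CriticalPhenomena.SAWScalingLimit.Cruxes.ObservableToSLE.Sketch

open scoped BigOperators Topology
open Filter Set
open Literature.Probability.RandomPlanarGeometry Literature.Probability.RandomPlanarGeometry.SAW
open Literature.Probability.LatticeModels

/-- S1 of card `floor-ratio-restriction-bootstrap`: the floor-ratio limit. Same quantifier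
shape as `HexObservableLimit` (route SAWDevelopingMap), with TWO normalisation mid-edges `b δ → D.pt 1`
and `b' δ → D'.pt 1` on the same horizontal floor (same row threshold `m δ`, domain above), `D'` a
re-marking of the same Jordan domain with the same source, `L' = L` on the carrier (the two
uniformizers differ by a real translation). Conclusion: `F δ (b' δ) / F δ (b δ) → exp((5/8)(Lb' − Lb))`,
i.e. `Z_δ(a→b′)/Z_δ(a→b) → (φ′(b′)/φ′(b))^{5/8}` up to the deterministic boundary phase. -/
def FloorRatioLimit : Prop :=
  ∀ (D D' : DobrushinDomain) (ρ : ℝ) (Λ : ℝ → Finset HexVertex) (m : ℝ → ℤ)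
    (a b b' : ℝ → Sym2 HexVertex)
    (Φ : ConformalEquiv D.carrier UpperHalfPlane.upperHalfPlaneSet)
    (L : ℂ → ℂ) (Lb Lb' : ℂ),
    let F : ℝ → Sym2 HexVertex → ℂ := fun δ z =>
      hexParafermionicObservable (Λ δ) (a δ) hexCriticalFugacity (5 / 8) z
    D'.carrier = D.carrier → D'.pt 0 = D.pt 0 → (D'.pt 1).im = (D.pt 1).im → 0 < ρ →
    D.carrier ∩ Metric.ball (D.pt 1) ρ = {z : ℂ | (D.pt 1).im < z.im} ∩ Metric.ball (D.pt 1) ρ →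
    D.carrier ∩ Metric.ball (D'.pt 1) ρ = {z : ℂ | (D'.pt 1).im < z.im} ∩ Metric.ball (D'.pt 1) ρ →
    (∀ᶠ δ : ℝ in 𝓝[>] 0,
      hexDomainSimplyConnected (Λ δ) ∧ a δ ∈ hexDomainBoundary (Λ δ) ∧
      b δ ∈ hexDomainBoundary (Λ δ) ∧ b' δ ∈ hexDomainBoundary (Λ δ) ∧
      Nonempty (HexMidEdgeSAW (Λ δ) (a δ) (b δ)) ∧ Nonempty (HexMidEdgeSAW (Λ δ) (a δ) (b' δ)) ∧
      (hexGraph.induce ((Λ δ : Finset HexVertex) : Set HexVertex)).Preconnected ∧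
      (∀ v ∈ Λ δ, (δ : ℂ) * hexCenter v ∈ D.carrier) ∧
      (∀ v : HexVertex, (δ : ℂ) * hexCenter v ∈ Metric.ball (D.pt 1) ρ ∪ Metric.ball (D'.pt 1) ρ →
        (v ∈ Λ δ ↔ m δ ≤ v.1 1))) →
    (∀ K : Set ℂ, IsCompact K → K ⊆ D.carrier →
      ∀ᶠ δ : ℝ in 𝓝[>] 0, ∀ v : HexVertex, (δ : ℂ) * hexCenter v ∈ K → v ∈ Λ δ) →
    Tendsto (fun δ : ℝ => (δ : ℂ) * hexMidpoint (a δ)) (𝓝[>] 0) (𝓝 (D.pt 0)) →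
    Tendsto (fun δ : ℝ => (δ : ℂ) * hexMidpoint (b δ)) (𝓝[>] 0) (𝓝 (D.pt 1)) →
    Tendsto (fun δ : ℝ => (δ : ℂ) * hexMidpoint (b' δ)) (𝓝[>] 0) (𝓝 (D'.pt 1)) →
    Tendsto (fun x => ‖Φ x‖) (𝓝[D.carrier] (D.pt 0)) atTop →
    Φ.HasBoundaryValue (D.pt 1) 0 →
    ContinuousOn L D.carrier → (∀ z ∈ D.carrier, Complex.exp (L z) = deriv Φ z) →
    Tendsto L (𝓝[D.carrier] (D.pt 1)) (𝓝 Lb) → Tendsto L (𝓝[D.carrier] (D'.pt 1)) (𝓝 Lb') →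
    Tendsto (fun δ : ℝ => F δ (b' δ) / F δ (b δ)) (𝓝[>] 0)
      (𝓝 (Complex.exp ((5 / 8 : ℂ) * (Lb' - Lb))))

/-- The first lemma of the line, as an implication from the crux's own hypothesis. -/
def FloorRatioFromObservable : Prop :=
  Theses.SAWDevelopingMap.HexObservableLimit → FloorRatioLimit

/-- ANCHOR of card `floor-ratio-restriction-bootstrap` (the one SAW a-priori estimate): short floor
chords of the critical hexagonal SAW are local, uniformly in the scale and in floor-supported
domains. Lattice units: `s, t` floor mid-edges at distance `≤ n` on the bottom row of a domain `Λ`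
lying above that row and containing the whole half-box of radius `2Kn` around `s`; the `x_c`-mass of
walks `s → t` reaching distance `≥ K n` from `s` is at most `ε` times the total mass. -/
def ShortChordLocality : Prop :=
  ∀ ε : ℝ, 0 < ε → ∃ K : ℝ, 0 < K ∧ ∀ (n : ℕ), 1 ≤ n → ∀ (Λ : Finset HexVertex)
    (s t : Sym2 HexVertex), hexDomainSimplyConnected Λ →
    s ∈ hexDomainBoundary Λ → t ∈ hexDomainBoundary Λ → s ≠ t →
    dist (hexMidpoint s) (hexMidpoint t) ≤ n →
    (hexMidpoint t).im = (hexMidpoint s).im →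
    (∀ v ∈ Λ, (hexMidpoint s).im < (hexCenter v).im) →
    (∀ v : HexVertex, (hexMidpoint s).im < (hexCenter v).im →
      dist (hexCenter v) (hexMidpoint s) ≤ 2 * K * n → v ∈ Λ) →
    (∑ γ : HexMidEdgeSAW Λ s t,
        if ∃ v ∈ γ.verts, K * n ≤ dist (hexCenter v) (hexMidpoint s)
        then hexCriticalFugacity ^ γ.length else 0) ≤
      ε * ∑ γ : HexMidEdgeSAW Λ s t, hexCriticalFugacity ^ γ.length

/-- Card `reversed-tip-terminal-harnack`, first lemma (exact, provable now): reversing a walk negates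
its winding, so the observable with source `z` evaluated at `a` is the complex conjugate of the
observable with source `a` evaluated at `z` (real fugacity, any spin). Applied with `a` = the tip of
the slit and `z` a bulk point / the flat point `b`, it rewrites the tip-sourced DCS martingale as a
ratio of two nice-sourced objects evaluated AT the tip. -/
def TipReversal : Prop :=
  ∀ (Λ : Finset HexVertex) (a z : Sym2 HexVertex) (x σ : ℝ),
    a ∈ hexDomainMidEdges Λ → z ∈ hexDomainMidEdges Λ →
    hexParafermionicObservable Λ z x σ a = (starRingEnd ℂ) (hexParafermionicObservable Λ a x σ z)

/-- Card `reversed-tip-terminal-harnack`, the open input (phase-free core): TERMINAL BOUNDARY HARNACK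
for critical hexagonal SAW masses. For two sources `s₁, s₂` far (`≥ R²`) from a boundary mid-edge `x` of
ANY simply connected domain, the source-ratio of the `x_c`-masses (`σ = 0` observable = generating
function) is almost the same at all targets `y, y'` within distance `R` of `x`: walks entering a rough
boundary region forget where they came from. -/
def TerminalHarnack : Prop :=
  ∀ ε : ℝ, 0 < ε → ∃ R₀ : ℝ, ∀ R : ℝ, R₀ ≤ R → ∀ (Λ : Finset HexVertex)
    (x s₁ s₂ y y' : Sym2 HexVertex), hexDomainSimplyConnected Λ →
    x ∈ hexDomainBoundary Λ → s₁ ∈ hexDomainMidEdges Λ → s₂ ∈ hexDomainMidEdges Λ →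
    y ∈ hexDomainMidEdges Λ → y' ∈ hexDomainMidEdges Λ →
    R ^ 2 ≤ dist (hexMidpoint s₁) (hexMidpoint x) → R ^ 2 ≤ dist (hexMidpoint s₂) (hexMidpoint x) →
    dist (hexMidpoint y) (hexMidpoint x) ≤ R → dist (hexMidpoint y') (hexMidpoint x) ≤ R →
    let Z : Sym2 HexVertex → Sym2 HexVertex → ℝ := fun s w =>
      (hexParafermionicObservable Λ s hexCriticalFugacity 0 w).re
    0 < Z s₂ y → 0 < Z s₁ y' → 0 < Z s₂ y' →
    |(Z s₁ y / Z s₂ y) / (Z s₁ y' / Z s₂ y') - 1| ≤ ε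

end Summit.CriticalPhenomena.SAWScalingLimit.Cruxes.ObservableToSLE.Sketch
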